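import Literature.NumberTheory.EllipticCurves.ComplexMultiplicationDeuringLocal
import Literature.NumberTheory.EllipticCurves.LocalEulerFactorRingEquivProofs
import Literature.NumberTheory.Automorphic.AdicCompletionDegreeOnePlaceProofs
import Mathlib.NumberTheory.RamificationInertia.Galois
import HarnessLib

/-!
# Deuring's theorem place by place: split primes proved, inert and ramified primes as leaves

Sibling file of `Literature.NumberTheory.EllipticCurves.ComplexMultiplicationDeuringLocal`,
third level of the decomposition of
`Literature.NumberTheory.EllipticCurves.Deuring_LFunction_baseChange_cmField` (Deuring's
`L(E_K/K, s) = L(E/ℚ, s)²`, Silverman, *Advanced Topics*, II Thm. 10.5 (a), (b)). The second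
level reduced it to the per-rational-prime identity
`Deuring_localEulerFactor_baseChange_cmField` (★ₚ): `∏_{w ∣ p} L_w(E_K)⁻¹ = (L_p(E)⁻¹)²` for
Mathlib's local Euler factors. Following Silverman's Exercise 2.32(a) (PDF p. 179), (★ₚ) splits
according to the decomposition of `p` in the quadratic field `K`:

* **`p = 𝔓'𝔓''` split.** Then `K_{𝔓'} = ℚ_p` and the local factor of `E_K` at `𝔓'` *is* the
  local factor of `E` at `p` — for *every* elliptic curve over `ℚ`, indeed for every extension
  of number fields `K/F` and place `w` with `e(w|v) = f(w|v) = 1`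
  (`WeierstrassCurve.localEulerFactor_baseChange_eq_of_ramificationIdx_eq_one_of_inertiaDeg_eq_one`,
  **proved** here from the isomorphism of discretely valued fields `F_v ≃ K_w`,
  `Literature.NumberTheory.Automorphic.exists_ringEquiv_adicCompletion_of_ramificationIdx_eq_one_of_inertiaDeg_eq_one`,
  and the transport lemma `WeierstrassCurve.localEulerFactor_map_ringEquiv`). Hence
  `L_{𝔓'} L_{𝔓''} = L_p²` with no complex multiplication needed (Silverman's
  `q_𝔓 = q_{𝔓'} = q_{𝔓''}`, `a_𝔓 = ψ(𝔓') + ψ(𝔓'')`, Ex. 2.30(b)).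
* **`p = 𝔓'` inert.** (★ₚ) reads `L_{𝔓'}(E_K)⁻¹ = (L_p(E)⁻¹)²`: at a good prime this is
  Deuring's supersingularity `a_p = 0` (Ex. 2.30(c): `ψ(𝔓') = -p`) together with
  `a_{𝔓'} = -2p`, i.e. `#Ẽ(𝔽_{p²}) = (p + 1)²`, and at a bad prime both factors are `1`
  (Ex. 2.31(b), no multiplicative reduction). This is the genuinely CM (and deep) part; it is
  the hypothesis `hI` of the assembly below.
* **`p = 𝔓'²` ramified.** `E` has bad (additive) reduction at `p` (Ex. 2.31(a), 2.32(a):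
  `L_p = 1`) and `E_K` has bad reduction at `𝔓'` (`ψ_{E/K}` is ramified at `𝔓'`: 2.32(b) with
  (a) forces `ψ(𝔓') = 0`, and Thm. 9.2(b)), so `L_{𝔓'} = 1`; the hypothesis `hR` of the
  assembly below.

The case distinction itself — for `[K : ℚ] = 2` and a rational prime `p`, either two places of
`K` above `p` with `e = f = 1`, or one with `(e, f) = (1, 2)`, or one with `(e, f) = (2, 1)` — is
**proved** (`placesOver_trichotomy_of_finrank_eq_two`, from Mathlib's fundamental identity
`#{𝔓 ∣ p} · e · f = [K : ℚ]` for Galois extensions), and so is the assembly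
`Deuring_localEulerFactor_baseChange_cmField_of_inert_of_ramified`: the inert and ramified
statements — taken as explicit hypotheses spelled out in Mathlib's terms
(`w.asIdeal.inertiaDeg (𝓞 ℚ) = 2`, `w.asIdeal.ramificationIdx (𝓞 ℚ) = 2`); no new named fact is
introduced here (D-0026) — imply (★ₚ), hence (`Deuring_LFunction_baseChange_cmField_of_local`)
Deuring's theorem. After this file the open content of the Deuring leaf of bsd.S28 is exactly
Deuring's theorem at the inert primes and at the ramified primes of the CM field, in the shape
of those two hypotheses (their `W.j ∈ maximalCMJInvariants`, `IsCMFieldOfJ K W.j`, `K : Type`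
are those of (★ₚ) verbatim).

## References

* J. H. Silverman, *Advanced Topics in the Arithmetic of Elliptic Curves*, GTM 151 (1994),
  Ch. II §10, Thm. 10.5 and its proof (PDF pp. 171–172), Exercises 2.30–2.32 (PDF p. 179),
  Thm. 9.2(b). [SilvermanATAEC1994]
* J. W. S. Cassels, A. Fröhlich (eds.), *Algebraic Number Theory* (1967), Ch. II §10.
  [CasselsFrohlichANT1967]
-/

noncomputable section

open scoped Classical

open IsDedekindDomain NumberField

/-! ### Split places: the local factor of the base change is the local factor below -/

namespace WeierstrassCurve

/-- **At a place of degree one the local Euler factor of the base change is the local Euler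
factor below.** Let `K/F` be number fields, `X/F` an elliptic curve and `w` a finite place of
`K` with `e(w|v) = f(w|v) = 1` over `v = w ∩ 𝓞 F`. Then Mathlib's local Euler factor of `X_K`
at `w` equals that of `X` at `v`: the completions are isomorphic as discretely valued fields,
`(𝒪_v ⊆ F_v) ≃ (𝒪_w ⊆ K_w)` compatibly with `F → K`
(`Literature.NumberTheory.Automorphic.exists_ringEquiv_adicCompletion_of_ramificationIdx_eq_one_of_inertiaDeg_eq_one`),
`X_K ⊗ K_w` is the image of `X ⊗ F_v`, and the local Euler factor is invariant under such
isomorphisms (`localEulerFactor_map_ringEquiv`). For `F = ℚ` and `K` quadratic this is the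
split case of Artin formalism and of Deuring's theorem (Silverman, *Advanced Topics*,
Ex. 2.30(b), 2.32(a): `q_p = q_{𝔓'} = q_{𝔓''}`, `L_{𝔓'} = L_{𝔓''} = L_p`). [folklore] -/
theorem localEulerFactor_baseChange_eq_of_ramificationIdx_eq_one_of_inertiaDeg_eq_one
    {F K : Type*} [Field F] [NumberField F] [Field K] [NumberField K] [Algebra F K]
    (X : WeierstrassCurve F) [X.IsElliptic] (w : HeightOneSpectrum (𝓞 K))
    (he : w.asIdeal.ramificationIdx (𝓞 F) = 1) (hf : w.asIdeal.inertiaDeg (𝓞 F) = 1) :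
    ((X.baseChange K).baseChange (w.adicCompletion K)).localEulerFactor
        (w.adicCompletionIntegers K) =
      (X.baseChange ((w.under (𝓞 F)).adicCompletion F)).localEulerFactor
        ((w.under (𝓞 F)).adicCompletionIntegers F) := by
  set v : HeightOneSpectrum (𝓞 F) := w.under (𝓞 F) with hv
  haveI : w.asIdeal.LiesOver v.asIdeal := ⟨rfl⟩
  obtain ⟨ψ, φ, hc, hφ⟩ := Literature.NumberTheory.Automorphic.exists_ringEquiv_adicCompletion_of_ramificationIdx_eq_one_of_inertiaDeg_eq_one
    F K v w he hf
  have hX : (X.baseChange K).baseChange (w.adicCompletion K) =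
      (X.baseChange (v.adicCompletion F)).map (φ : v.adicCompletion F →+* w.adicCompletion K) := by
    simp only [baseChange, map_map]
    congr 1
    refine RingHom.ext fun x ↦ ?_
    simp only [RingHom.coe_comp, Function.comp_apply, RingHom.coe_coe]
    exact (hφ x).symm
  haveI : (X.baseChange (v.adicCompletion F)).IsElliptic := by rw [baseChange]; infer_instance
  rw [hX, localEulerFactor_map_ringEquiv ψ φ hc]

end WeierstrassCurve

namespace Literature.NumberTheory.EllipticCurves

open WeierstrassCurve

/-! ### The places of a quadratic field above a rational prime -/

/-- **Decomposition of a rational prime in a quadratic field, place by place.** Let `K` be a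
number field with `[K : ℚ] = 2` and `v` a finite place of `ℚ`. Then exactly one of: (split)
there are two places `w₁ ≠ w₂` of `K` above `v`, each with `e = f = 1`; (inert) there is a
single place above `v`, with `e = 1`, `f = 2`; (ramified) there is a single place above `v`,
with `e = 2`, `f = 1`. From Mathlib's fundamental identity for the Galois extension `K/ℚ`,
`#{w ∣ v} · e · f = [K : ℚ] = 2` (`Ideal.ncard_primesOver_mul_ramificationIdxIn_mul_inertiaDegIn`,
all places above `v` having the same `e` and `f`). (Marcus, *Number Fields*, Ch. 3 Thm. 25;
Neukirch I (8.2).) [folklore] -/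
theorem placesOver_trichotomy_of_finrank_eq_two (K : Type*) [Field K] [NumberField K]
    (h2 : Module.finrank ℚ K = 2) (v : HeightOneSpectrum (𝓞 ℚ)) :
    (∃ w₁ w₂ : HeightOneSpectrum (𝓞 K), w₁ ≠ w₂ ∧
        {w : HeightOneSpectrum (𝓞 K) | w.under (𝓞 ℚ) = v} = {w₁, w₂} ∧
        ∀ w : HeightOneSpectrum (𝓞 K), w.under (𝓞 ℚ) = v →
          w.asIdeal.ramificationIdx (𝓞 ℚ) = 1 ∧ w.asIdeal.inertiaDeg (𝓞 ℚ) = 1) ∨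
    (∃ w : HeightOneSpectrum (𝓞 K), {w' : HeightOneSpectrum (𝓞 K) | w'.under (𝓞 ℚ) = v} = {w} ∧
        w.asIdeal.ramificationIdx (𝓞 ℚ) = 1 ∧ w.asIdeal.inertiaDeg (𝓞 ℚ) = 2) ∨
    (∃ w : HeightOneSpectrum (𝓞 K), {w' : HeightOneSpectrum (𝓞 K) | w'.under (𝓞 ℚ) = v} = {w} ∧
        w.asIdeal.ramificationIdx (𝓞 ℚ) = 2 ∧ w.asIdeal.inertiaDeg (𝓞 ℚ) = 1) := by
  haveI : Algebra.IsQuadraticExtension ℚ K := ⟨h2⟩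
  haveI : v.asIdeal.IsMaximal := v.isMaximal
  set G := K ≃ₐ[ℚ] K with hG_def
  have hG : Nat.card G = 2 := by rw [hG_def, IsGalois.card_aut_eq_finrank, h2]
  -- the fundamental identity `n · (e · f) = 2`
  set n := (v.asIdeal.primesOver (𝓞 K)).ncard with hn_def
  set e := v.asIdeal.ramificationIdxIn (𝓞 K) with he_def
  set f := v.asIdeal.inertiaDegIn (𝓞 K) with hf_def
  have hid : n * (e * f) = 2 := by
    rw [hn_def, he_def, hf_def, Ideal.ncard_primesOver_mul_ramificationIdxIn_mul_inertiaDegIn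
      v.asIdeal (𝓞 K) G, hG]
  have hn0 : n ≠ 0 := IsDedekindDomain.primesOver_ncard_ne_zero v.asIdeal (𝓞 K)
  have he0 : e ≠ 0 := Ideal.ramificationIdxIn_ne_zero G
  have hf0 : f ≠ 0 := Ideal.inertiaDegIn_ne_zero G
  -- `e(w|v) = e`, `f(w|v) = f` for every place `w` above `v`
  have hef : ∀ w : HeightOneSpectrum (𝓞 K), w.under (𝓞 ℚ) = v →
      w.asIdeal.ramificationIdx (𝓞 ℚ) = e ∧ w.asIdeal.inertiaDeg (𝓞 ℚ) = f := by
    intro w hw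
    haveI : w.asIdeal.LiesOver v.asIdeal := ⟨by rw [← hw]; rfl⟩
    exact ⟨(Ideal.ramificationIdxIn_eq_ramificationIdx v.asIdeal w.asIdeal G).symm,
      (Ideal.inertiaDegIn_eq_inertiaDeg v.asIdeal w.asIdeal G).symm⟩
  -- the places above `v` are the primes over `v.asIdeal`
  have hcard : Nat.card {w : HeightOneSpectrum (𝓞 K) // w.under (𝓞 ℚ) = v} = n := by
    rw [hn_def, ← Nat.card_coe_set_eq]
    refine Nat.card_congr
      { toFun := fun w ↦ ⟨w.1.asIdeal, w.1.isPrime, ⟨(congrArg HeightOneSpectrum.asIdeal w.2).symm⟩⟩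
        invFun := fun P ↦ ⟨⟨P.1, P.2.1, Ideal.ne_bot_of_mem_primesOver v.ne_bot P.2⟩,
          HeightOneSpectrum.ext P.2.2.over.symm⟩
        left_inv := fun w ↦ by ext1; rfl
        right_inv := fun P ↦ by rfl }
  -- arithmetic: `(n, e, f) ∈ {(2, 1, 1), (1, 1, 2), (1, 2, 1)}`
  have hn2 : n ≤ 2 := Nat.le_of_dvd two_pos ⟨e * f, hid.symm⟩
  have he2 : e ≤ 2 := Nat.le_of_dvd two_pos ⟨n * f, by rw [← hid]; ring⟩
  interval_cases n
  · exact absurd rfl hn0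
  · -- one place above `v`
    rw [one_mul] at hid
    obtain ⟨w₀, hw₀⟩ := Nat.card_eq_one_iff_exists.mp hcard
    have hset : {w' : HeightOneSpectrum (𝓞 K) | w'.under (𝓞 ℚ) = v} = {w₀.1} := by
      ext w'
      simp only [Set.mem_setOf_eq, Set.mem_singleton_iff]
      exact ⟨fun h ↦ congrArg Subtype.val (hw₀ ⟨w', h⟩), fun h ↦ h ▸ w₀.2⟩
    obtain ⟨hew, hfw⟩ := hef w₀.1 w₀.2
    interval_cases e
    · exact absurd rfl he0
    · right; left
      exact ⟨w₀.1, hset, hew, by rw [hfw]; omega⟩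
    · right; right
      exact ⟨w₀.1, hset, hew, by rw [hfw]; omega⟩
  · -- two places above `v`
    left
    obtain ⟨x, y, hxy, hxy'⟩ := Nat.card_eq_two_iff.mp hcard
    have hef1 : e = 1 ∧ f = 1 := by
      have : e * f = 1 := by omega
      exact ⟨Nat.eq_one_of_mul_eq_one_right this, Nat.eq_one_of_mul_eq_one_left this⟩
    refine ⟨x.1, y.1, fun h ↦ hxy (Subtype.ext h), ?_, fun w hw ↦ ?_⟩
    · ext w'
      simp only [Set.mem_setOf_eq, Set.mem_insert_iff, Set.mem_singleton_iff]
      constructor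
      · intro h
        have hmem : (⟨w', h⟩ : {w : HeightOneSpectrum (𝓞 K) // w.under (𝓞 ℚ) = v}) ∈
            ({x, y} : Set _) := by rw [hxy']; exact Set.mem_univ _
        rcases hmem with h1 | h1
        · exact Or.inl (congrArg Subtype.val h1)
        · exact Or.inr (congrArg Subtype.val h1)
      · rintro (rfl | rfl)
        · exact x.2
        · exact y.2
    · obtain ⟨hew, hfw⟩ := hef w hw
      exact ⟨hew.trans hef1.1, hfw.trans hef1.2⟩

/-! ### Assembly: (★ₚ) from the split case (proved) and the inert and ramified cases -/

/-- **Deuring's theorem prime by prime from its inert and ramified cases.** Suppose that for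
every elliptic `W/ℚ` with `W.j ∈ maximalCMJInvariants` and `K` its CM field
(`IsCMFieldOfJ K W.j`):

* (`hI`, inert primes — Silverman, *Advanced Topics*, Ex. 2.30(c), 2.31(b), 2.32(a) with the
  proof of Thm. 10.5(a): `L_p(E, T) = 1 + pT²`, `L_{𝔓'}(E_K, T') = (1 + pT')²`, `T' = T²`, or
  both `1` at a bad prime) at every place `w` of `K` of residue degree `f(w|p) = 2` the local
  Euler factor of `E_K` is the square of that of `E` at `p`, as Dirichlet series in `p^{-s}`;
* (`hR`, ramified primes — Ex. 2.31(a), 2.32(a),(b), Thm. 9.2(b): bad, hence additive,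
  reduction of `E` at `p` and of `E_K` at `𝔓'`) at every place `w` of `K` of ramification
  index `e(w|p) = 2` both local Euler factors are `1`.

Then the per-prime identity `Deuring_localEulerFactor_baseChange_cmField` (★ₚ) holds at every
rational prime: by `placesOver_trichotomy_of_finrank_eq_two` the prime is split, inert or
ramified in the quadratic field `K`; at a split prime the two factors of `E_K` are both
`L_p(E)` (`WeierstrassCurve.localEulerFactor_baseChange_eq_of_ramificationIdx_eq_one_of_inertiaDeg_eq_one`,
proved for every elliptic curve), at an inert prime the single factor is `L_p²` (`hI`), at a
ramified prime it is `1 = 1² = L_p²` (`hR`). Silverman, *Advanced Topics*, Ex. 2.32(a) ⇒ (b).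
The two hypotheses are spelled out rather than vendored as named facts (D-0026); they are the
remaining open content of the Deuring leaf.
[cite: SilvermanATAEC1994, Ch. II Exercises 2.30–2.32 (PDF p. 179) with Thm. 10.5 (a) and its proof (PDF pp. 171–172)] -/
theorem Deuring_localEulerFactor_baseChange_cmField_of_inert_of_ramified
    (hI : ∀ (W : WeierstrassCurve ℚ) [W.IsElliptic], W.j ∈ maximalCMJInvariants →
      ∀ (K : Type) [Field K] [NumberField K], IsCMFieldOfJ K W.j →
        ∀ w : HeightOneSpectrum (𝓞 K), w.asIdeal.inertiaDeg (𝓞 ℚ) = 2 →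
          ((W.baseChange K).baseChange (w.adicCompletion K)).localEulerFactor
              (w.adicCompletionIntegers K) =
            (W.baseChange ((w.under (𝓞 ℚ)).adicCompletion ℚ)).localEulerFactor
              ((w.under (𝓞 ℚ)).adicCompletionIntegers ℚ) ^ 2)
    (hR : ∀ (W : WeierstrassCurve ℚ) [W.IsElliptic], W.j ∈ maximalCMJInvariants →
      ∀ (K : Type) [Field K] [NumberField K], IsCMFieldOfJ K W.j →
        ∀ w : HeightOneSpectrum (𝓞 K), w.asIdeal.ramificationIdx (𝓞 ℚ) = 2 →
          ((W.baseChange K).baseChange (w.adicCompletion K)).localEulerFactor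
              (w.adicCompletionIntegers K) = 1 ∧
            (W.baseChange ((w.under (𝓞 ℚ)).adicCompletion ℚ)).localEulerFactor
              ((w.under (𝓞 ℚ)).adicCompletionIntegers ℚ) = 1) :
    Deuring_localEulerFactor_baseChange_cmField := by
  intro W _ hj K _ _ hK v
  rcases placesOver_trichotomy_of_finrank_eq_two K hK.1 v with
    ⟨w₁, w₂, hne, hset, hef⟩ | ⟨w, hset, he, hf⟩ | ⟨w, hset, he, hf⟩
  · -- split
    have hw₁ : w₁.under (𝓞 ℚ) = v := by
      have h : w₁ ∈ ({w₁, w₂} : Set (HeightOneSpectrum (𝓞 K))) := Set.mem_insert _ _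
      rwa [← hset] at h
    have hw₂ : w₂.under (𝓞 ℚ) = v := by
      have h : w₂ ∈ ({w₁, w₂} : Set (HeightOneSpectrum (𝓞 K))) :=
        Set.mem_insert_of_mem _ (Set.mem_singleton _)
      rwa [← hset] at h
    obtain ⟨he₁, hf₁⟩ := hef w₁ hw₁
    obtain ⟨he₂, hf₂⟩ := hef w₂ hw₂
    rw [hset, finprod_mem_pair hne,
      localEulerFactor_baseChange_eq_of_ramificationIdx_eq_one_of_inertiaDeg_eq_one W w₁ he₁ hf₁,
      localEulerFactor_baseChange_eq_of_ramificationIdx_eq_one_of_inertiaDeg_eq_one W w₂ he₂ hf₂,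
      hw₁, hw₂, sq]
  · -- inert
    have hw : w.under (𝓞 ℚ) = v := by
      have h : w ∈ ({w} : Set (HeightOneSpectrum (𝓞 K))) := Set.mem_singleton _
      rwa [← hset] at h
    rw [hset, finprod_mem_singleton, hI W hj K hK w hf, hw]
  · -- ramified
    have hw : w.under (𝓞 ℚ) = v := by
      have h : w ∈ ({w} : Set (HeightOneSpectrum (𝓞 K))) := Set.mem_singleton _
      rwa [← hset] at h
    obtain ⟨h1, h2⟩ := hR W hj K hK w he
    rw [hw] at h2
    rw [hset, finprod_mem_singleton, h1, h2, one_pow]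

/-- **Deuring's `L(E_K/K, s) = L(E/ℚ, s)²` from its inert and ramified cases** (with the
split case and all the bookkeeping proved): under the hypotheses `hI`, `hR` of
`Deuring_localEulerFactor_baseChange_cmField_of_inert_of_ramified`,
`Deuring_LFunction_baseChange_cmField` holds (`Deuring_LFunction_baseChange_cmField_of_local`).
[cite: SilvermanATAEC1994, Ch. II Thm. 10.5 (a), (b) and Exercise 2.32 (PDF pp. 171, 179)] -/
theorem Deuring_LFunction_baseChange_cmField_of_inert_of_ramified
    (hI : ∀ (W : WeierstrassCurve ℚ) [W.IsElliptic], W.j ∈ maximalCMJInvariants →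
      ∀ (K : Type) [Field K] [NumberField K], IsCMFieldOfJ K W.j →
        ∀ w : HeightOneSpectrum (𝓞 K), w.asIdeal.inertiaDeg (𝓞 ℚ) = 2 →
          ((W.baseChange K).baseChange (w.adicCompletion K)).localEulerFactor
              (w.adicCompletionIntegers K) =
            (W.baseChange ((w.under (𝓞 ℚ)).adicCompletion ℚ)).localEulerFactor
              ((w.under (𝓞 ℚ)).adicCompletionIntegers ℚ) ^ 2)
    (hR : ∀ (W : WeierstrassCurve ℚ) [W.IsElliptic], W.j ∈ maximalCMJInvariants →
      ∀ (K : Type) [Field K] [NumberField K], IsCMFieldOfJ K W.j →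
        ∀ w : HeightOneSpectrum (𝓞 K), w.asIdeal.ramificationIdx (𝓞 ℚ) = 2 →
          ((W.baseChange K).baseChange (w.adicCompletion K)).localEulerFactor
              (w.adicCompletionIntegers K) = 1 ∧
            (W.baseChange ((w.under (𝓞 ℚ)).adicCompletion ℚ)).localEulerFactor
              ((w.under (𝓞 ℚ)).adicCompletionIntegers ℚ) = 1) :
    Deuring_LFunction_baseChange_cmField :=
  Deuring_LFunction_baseChange_cmField_of_local
    (Deuring_localEulerFactor_baseChange_cmField_of_inert_of_ramified hI hR)

end Literature.NumberTheory.EllipticCurves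

end
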